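import Literature.Analysis.FluidPDE.ClassicalSolution
import Literature.Analysis.FluidPDE.SolenoidalTruncation
import HarnessLib

/-!
# The Euler / Navier–Stokes generation map of a merger ladder (route-posited object)

Topic `Literature/Analysis/FluidPDE`. **Interface only** — nothing here asserts the existence of
events or fixed points. Requested by the Navier–Stokes route `MergerLadder` (definition item
`defn-EulerGenerationMap`, crux `GenerationMapFixedPoint`): the *generation map* `𝓡` = one
merge–collide–stretch event of smooth incompressible dynamics, read on a section `Σ` of normalised
pre-merger configurations and renormalised by the similarity lengths `× s`, velocities `÷ 2s`
(circulation `Γ = Uℓ`, doubled by the merger, is halved back), after [Feigenbaum1978]'s doubling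
operator in [Lanfordiii1982]'s function-space setting, transplanted to vortex dynamics
([BrennerHormozPumir2016]: iterated cascade as a discrete generation map with fixed scale factor;
[Mailybaev2013]: blow-up as a renormalisation fixed point). The hyperbolicity predicate is the
accepted `Literature.Dynamics.FixedPoints.IsHyperbolicFixedPoint S R X`; the crux reads
`∃ 𝔖 : MergerSection, ∃ s ≥ 4, ∃ X, IsHyperbolicFixedPoint 𝔖.carrier (𝔖.eulerGenerationMap s) X`.

## Contents (all real definitions; `Option` encodes partiality)

`IsSolenoidalTestField` (configuration space `𝒯 = C_{c,σ}^∞`), the similarity action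
`rescaleField`/`rigidAct` and the renormalisation `generationRescale s`, the evolution
`classicalFlowAt ν T X` (time-`T` slice of *the* tame classical solution, `some _` iff it exists
and is unique — `classicalFlowAt_eq_some_iff`; no uniqueness theorem is assumed), the structure
`MergerSection` (section `Σ = carrier` + event predicate), the event functional
`eventTime : (0, ∞]` with the attained `IsFirstEventTime`, and the maps `generationMap ν s`,
`eulerGenerationMap s = generationMap 0 s`, `nsGenerationMap s ν = generationMap ν s`:
`𝓡 X = some Y` iff `X ∈ Σ` and `Y` is the *unique* element of `Σ` of the form
`solenoidalTruncation (rigidAct Q b (generationRescale s (Φ_τ X))) ρ`, `τ` the first event time,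
`(Q, b)` a rigid motion (`generationMap_eq_some_iff`); `𝓡` is a partial self-map of `Σ`
(`mem_carrier_of_generationMap_eq_some`).

## Modelling choices fixed here (as requested), and why

1. **Velocity formulation, compact support** (the route's cruxes are typed over velocities;
   `HasRapidSpatialDecay (u 0)` holds for test fields; localisation produces compact support).
2. **Localisation = the accepted `solenoidalTruncation · ρ`** (Poincaré homotopy corrector:
   smooth, divergence free, supported in `‖x‖ ≤ 2ρ`, *equal to the field on `B_ρ`*, depending
   only on the field in `B_{2ρ}`) — the analogue of restricting `f∘f` to the central subinterval;
   this is how shed structures (other daughters, partner, far field) are treated: discarded outside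
   `B_{2ρ}` of the normalised daughter. Cutting the *vorticity* is not an option: vortex lines are
   frozen into smooth Euler flows (supports never disconnect) and `χω` is not a curl.
3. **Daughter identification is delegated to the section** (`IsNormalised`, `EventCompleted`:
   intended instance — cores = components of `{‖ω‖ > θ‖ω‖_∞}`, circulation audit by
   `r⁻¹∫_{B_r}‖ω‖`, phase conditions fixing the frame), constrained by three axioms. The map
   enforces the section property itself (non-unique representative ⇒ `none`), and the
   **centring axiom** excludes kinematic coincidences: at a fixed point `‖curl X‖_∞` is attained
   in `B_ρ`, where `𝓡 X = X` is an exact rescaled rigid image of `Φ_τ X`, so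
   `‖curl (Φ_τ X)‖_∞ ≥ 2s² ‖curl X‖_∞` — genuine vorticity amplification within one generation;
   for `2s² > 1` steady, travelling or rigidly rotating states are never fixed points.
4. **No chart is fixed here.** Fréchet differentiability of `𝓡` in a fixed `C^{k,α}`/`H^m` norm is
   not to be expected (the Euler data-to-solution map is not uniformly continuous in `H^s`:
   Himonas–Misiołek, Comm. Math. Phys. 296 (2010), doi:10.1007/s00220-010-0991-1); Lanford's
   mechanism — an analytic/Gevrey class (Euler propagates Gevrey regularity: Kukavica–Vicol,
   Nonlinearity 24 (2011)) in which the magnification `× s` restores the radius lost during the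
   evolution — is available through `IsNormalised` and the existential chart.
5. **Energy affordability** `(2s)² s⁻³ ≤ 1/N` and the number `N` of daughter pairs are properties
   of would-be fixed points (the renormalisation alone multiplies energy by `s/4`; the
   localisation changes the field only outside `B_ρ`), not part of the map; `s` is free.

Tree search (`IsHyperbolic|generation|renormali|firstReturn|dilateField|rotateField`): the tree
has `nsRescaleData` (Leray scaling), Tao's `dilateField`/`rotateField` (amplitude tied to `λ^σ`,
no translations), `IsDiscretelySelfSimilar`/`IsRotatedDSS` (exact self-similarity of a whole
space–time field — what an event map avoids), `solenoidalTruncation`, the classical solution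
classes; nothing else of the above. Mathlib has none of it.

## References

* M. J. Feigenbaum, J. Stat. Phys. 19 (1978) 25–52. [Feigenbaum1978]
* O. E. Lanford III, Bull. AMS 6 (1982) 427–434, §1–2. [Lanfordiii1982]
* M. P. Brenner, S. Hormoz, A. Pumir, Phys. Rev. Fluids 1 (2016) 084503. [BrennerHormozPumir2016]
* A. A. Mailybaev, Nonlinearity 26 (2013) 1105–1124. [Mailybaev2013]
* A. J. Majda, A. L. Bertozzi, *Vorticity and Incompressible Flow* (CUP 2002), §1.2 Prop. 1.1
  (symmetries), §3.1.1 Cor. 3.1 (uniqueness by the energy method). [MajdaBertozziCUP2002]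
-/

noncomputable section

open MeasureTheory Set Function Filter TopologicalSpace Metric
open scoped ENNReal ContDiff

namespace Literature.Analysis.FluidPDE

/-- Local notation for physical space `ℝ³ = EuclideanSpace ℝ (Fin 3)`. -/
local notation "ℝ³" => EuclideanSpace ℝ (Fin 3)

/-! ### The configuration space: solenoidal test fields -/

/-- The **configuration space `𝒯`** of the generation map: `v : ℝ³ → ℝ³` is a *solenoidal test
field* — smooth, compactly supported (the accepted `IsTestFunctionOn ⊤`) and divergence free
(the accepted `IsDivFree`): the class of smooth compactly supported solenoidal fields of the
accepted `SolenoidalTruncation` file (`isTestFunctionOn_solenoidalTruncation`,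
`isDivFree_solenoidalTruncation`). [folklore] -/
def IsSolenoidalTestField (v : ℝ³ → ℝ³) : Prop :=
  FunctionSpaces.IsTestFunctionOn (⊤ : Opens ℝ³) v ∧ VectorCalculus.IsDivFree v

/-- **The localisation lands in the configuration space**: the solenoidal truncation at radius
`ρ > 0` of a smooth divergence-free field is a solenoidal test field (accepted
`isTestFunctionOn_solenoidalTruncation`, `isDivFree_solenoidalTruncation`). [folklore] -/
theorem isSolenoidalTestField_solenoidalTruncation {V : ℝ³ → ℝ³} (hV : ContDiff ℝ ∞ V)
    (hdiv : VectorCalculus.IsDivFree V) {ρ : ℝ} (hρ : 0 < ρ) :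
    IsSolenoidalTestField (solenoidalTruncation V ρ) :=
  ⟨isTestFunctionOn_solenoidalTruncation hV hρ,
    isDivFree_solenoidalTruncation (by simp) (hV.of_le (by exact_mod_cast le_top)) hdiv ρ⟩

/-! ### The similarity group acting on fields -/

section Similarity

variable {E : Type*} [NormedAddCommGroup E] [NormedSpace ℝ E]
variable {F : Type*} [NormedAddCommGroup F] [NormedSpace ℝ F]

/-- **Amplitude–dilation rescaling** of a field: `rescaleField a c v x = a • v (c • x)`
(amplitude `a`, inverse length `c`; the time-zero slice of the two-parameter Euler scaling
`u ↦ A u(Bx, ABt)` of Majda–Bertozzi, Prop. 1.1 (iii), with `A = a`, `B = c`; for `a = c` it is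
the accepted Leray scaling `nsRescaleData`). Total in `a, c` (no positivity). [cite: MajdaBertozziCUP2002, §1.2 Prop. 1.1 (iii)] -/
def rescaleField (a c : ℝ) (v : E → F) : E → F := fun x => a • v (c • x)

/-- **Rigid motions acting on vector fields** (push-forward by `x ↦ Q x + b`, `Q` a linear
isometry, including reflections): `rigidAct Q b v x = Q (v (Q⁻¹ (x - b)))` (Majda–Bertozzi,
Prop. 1.1 (i)–(ii): Galilean/rotation symmetry of Euler and Navier–Stokes at fixed time; for
`b = 0` the tree's `rotateField`). [cite: MajdaBertozziCUP2002, §1.2 Prop. 1.1 (i)–(ii)] -/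
def rigidAct (Q : E ≃ₗᵢ[ℝ] E) (b : E) (v : E → E) : E → E := fun x => Q (v (Q.symm (x - b)))

/-- Unfolding `rescaleField`. [folklore] -/
@[simp]
theorem rescaleField_apply (a c : ℝ) (v : E → F) (x : E) : rescaleField a c v x = a • v (c • x) :=
  rfl

/-- Unfolding `rigidAct`. [folklore] -/
@[simp]
theorem rigidAct_apply (Q : E ≃ₗᵢ[ℝ] E) (b : E) (v : E → E) (x : E) :
    rigidAct Q b v x = Q (v (Q.symm (x - b))) :=
  rfl

/-- Rescaling by `(1, 1)` is the identity. [folklore] -/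
@[simp]
theorem rescaleField_one_one (v : E → F) : rescaleField 1 1 v = v := by
  funext x; simp

/-- **Group law**: `rescaleField a c (rescaleField a' c' v) = rescaleField (a a') (c' c) v`. [folklore] -/
theorem rescaleField_rescaleField (a c a' c' : ℝ) (v : E → F) :
    rescaleField a c (rescaleField a' c' v) = rescaleField (a * a') (c' * c) v := by
  funext x; simp [smul_smul]

/-- The trivial rigid motion acts as the identity. [folklore] -/
@[simp]
theorem rigidAct_refl_zero (v : E → E) : rigidAct (LinearIsometryEquiv.refl ℝ E) 0 v = v := by
  funext x
  simp only [rigidAct_apply, sub_zero]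
  rfl

end Similarity

/-- The **renormalisation after one generation** of a merger ladder with spatial contraction `s`,
`generationRescale s v x = (2s)⁻¹ • v (s⁻¹ • x)`: lengths `× s`, velocity `÷ 2s`, vorticity
`÷ 2s²`, energy `× s/4` — it maps the daughter (spacing `1/s`, circulation `2`, velocity `2s`)
back to unit spacing and circulation, inverting the ladder's per-generation similarity
`Γ×2, ℓ×s⁻¹, U×2s, ω×2s²` (route MergerLadder). Meaningful for `0 < s` (there `s ≥ 4`). [folklore] -/
def generationRescale (s : ℝ) (v : ℝ³ → ℝ³) : ℝ³ → ℝ³ :=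
  rescaleField (2 * s)⁻¹ s⁻¹ v

/-- Unfolding `generationRescale`. [folklore] -/
@[simp]
theorem generationRescale_apply (s : ℝ) (v : ℝ³ → ℝ³) (x : ℝ³) :
    generationRescale s v x = (2 * s)⁻¹ • v (s⁻¹ • x) :=
  rfl

/-! ### The classical evolution `Φ_T` (Euler `ν = 0`, Navier–Stokes `ν > 0`) -/

/-- **Tame classical solutions from `X` on `[0, T]`**: `u` is the velocity of a classical
solution of the unforced incompressible Navier–Stokes (`ν > 0`) / Euler (`ν = 0`) equations on
`ℝ³ × [0, T]` (accepted `IsClassicalNSSolutionOn (Icc 0 T) ν 0 u p` for some pressure `p`) with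
`u 0 = X` and energy, velocity, velocity gradient bounded uniformly on `[0, T]` — the class of the
energy-method uniqueness theorem (Majda–Bertozzi, §3.1.1, (3.5), Cor. 3.1). [cite: MajdaBertozziCUP2002, §3.1.1 Cor. 3.1] -/
structure IsTameClassicalSolution (ν T : ℝ) (X : ℝ³ → ℝ³) (u : ℝ → ℝ³ → ℝ³) : Prop where
  /-- `(u, p)` is a classical solution on `[0, T]` for some pressure `p`. -/
  classical : ∃ p : ℝ → ℝ³ → ℝ, IsClassicalNSSolutionOn (Icc 0 T) ν 0 u p
  /-- The initial datum. -/
  initial : u 0 = X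
  /-- Uniform bounds on `[0, T]`: energy, velocity, velocity gradient. -/
  bounded : ∃ C : ℝ, ∀ t ∈ Icc 0 T,
    eEnergy (u t) ≤ ENNReal.ofReal C ∧ ∀ x, ‖u t x‖ ≤ C ∧ ‖fderiv ℝ (u t) x‖ ≤ C

open Classical in
/-- **The evolution `Φ_T X`** at viscosity `ν` (`ν = 0`: Euler): `some v` iff there is a tame
classical solution from `X` on `[0, T]` and all such solutions have the same time-`T` slice `v`
(`classicalFlowAt_eq_some_iff`); `none` if there is none (the solution does not stay classical up
to `T`) or if the slice is not unique (excluded by Majda–Bertozzi Cor. 3.1, not assumed). `0 < T`. [cite: MajdaBertozziCUP2002, §3.1.1 Cor. 3.1] -/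
def classicalFlowAt (ν T : ℝ) (X : ℝ³ → ℝ³) : Option (ℝ³ → ℝ³) :=
  if h : ∃! v : ℝ³ → ℝ³, ∃ u, IsTameClassicalSolution ν T X u ∧ u T = v then some h.exists.choose
  else none

/-- **Characterisation of the evolution**: `Φ_T X = some v` iff `v` is the time-`T` slice of a
tame classical solution from `X` and every tame classical solution from `X` on `[0, T]` has
slice `v` at `T`. [folklore] -/
theorem classicalFlowAt_eq_some_iff {ν T : ℝ} {X v : ℝ³ → ℝ³} :
    classicalFlowAt ν T X = some v ↔
      (∃ u, IsTameClassicalSolution ν T X u ∧ u T = v) ∧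
        ∀ v', (∃ u, IsTameClassicalSolution ν T X u ∧ u T = v') → v' = v := by
  classical
  by_cases h : ∃! v : ℝ³ → ℝ³, ∃ u, IsTameClassicalSolution ν T X u ∧ u T = v
  · have hc := h.exists.choose_spec
    rw [classicalFlowAt, dif_pos h]
    constructor
    · intro hv
      obtain rfl := Option.some_injective _ hv
      exact ⟨hc, fun v' hv' => h.unique hv' hc⟩
    · rintro ⟨hv, huniq⟩
      exact congrArg some (huniq _ hc)
  · rw [classicalFlowAt, dif_neg h]
    constructor
    · intro hv
      exact (Option.some_ne_none v hv.symm).elim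
    · rintro ⟨hv, huniq⟩
      exact (h ⟨v, hv, huniq⟩).elim

/-! ### The section of normalised pre-merger configurations and its event predicate -/

/-- **A merger section** `Σ` with its event predicate (new object posited by route MergerLadder;
template: [Lanfordiii1982], §1, the space `M` and the domain `𝒟(T) ⊂ M` cut out by open
conditions). The instantiator supplies the localisation radius `ρ`; the predicate `IsNormalised`
defining `Σ` (normalisation of translation, rotation, scale, amplitude — "the leading co-rotating
pair has unit circulation and unit spacing at the origin" — plus the open shape conditions
"pre-merger configuration" and, if desired, a regularity class); and `EventCompleted` on
*physical* fields ("the next merger has completed", e.g. by daughter identification through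
vorticity-core superlevel sets and a circulation audit). Axioms: normalised configurations are
solenoidal test fields and **centred** (the global maximum of `‖curl v‖` is positive and attained
in the open ball `B_ρ`, which the localisation keeps exactly); the event is a **shape** property
(similarity invariant). `Σ` is not asserted to be non-empty or a good section. [cite: Lanfordiii1982, §1 (M, 𝒟(T))] -/
structure MergerSection where
  /-- Localisation radius (in normalised, daughter units). -/
  ρ : ℝ
  /-- The localisation radius is positive. -/
  ρ_pos : 0 < ρ
  /-- The section: normalised pre-merger configurations. -/
  IsNormalised : (ℝ³ → ℝ³) → Prop
  /-- The event predicate on physical fields: "a merger has just completed". -/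
  EventCompleted : (ℝ³ → ℝ³) → Prop
  /-- Normalised configurations are smooth, compactly supported and divergence free. -/
  isSolenoidalTestField : ∀ ⦃v⦄, IsNormalised v → IsSolenoidalTestField v
  /-- Normalised configurations are centred: `‖curl v‖` attains a positive global maximum in `B_ρ`. -/
  centred : ∀ ⦃v⦄, IsNormalised v →
    ∃ x₀ ∈ ball (0 : ℝ³) ρ, 0 < ‖curl v x₀‖ ∧ ∀ x, ‖curl v x‖ ≤ ‖curl v x₀‖
  /-- The event is a shape property: invariant under the similarity group. -/
  eventCompleted_iff : ∀ ⦃a c : ℝ⦄, 0 < a → 0 < c → ∀ (Q : ℝ³ ≃ₗᵢ[ℝ] ℝ³) (b : ℝ³) (v : ℝ³ → ℝ³),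
    EventCompleted (rigidAct Q b (rescaleField a c v)) ↔ EventCompleted v

namespace MergerSection

variable (𝔖 : MergerSection)

/-- The **carrier** `Σ = {v | IsNormalised v}` of a merger section. [folklore] -/
def carrier : Set (ℝ³ → ℝ³) := {v | 𝔖.IsNormalised v}

/-- Membership in the carrier, unfolded. [folklore] -/
@[simp]
theorem mem_carrier_iff {v : ℝ³ → ℝ³} : v ∈ 𝔖.carrier ↔ 𝔖.IsNormalised v := Iff.rfl

/-- Elements of the section have non-zero vorticity (centring); so `0 ∉ Σ`. [folklore] -/
theorem curl_ne_zero_of_mem {v : ℝ³ → ℝ³} (hv : v ∈ 𝔖.carrier) : curl v ≠ 0 := by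
  obtain ⟨x₀, -, hpos, -⟩ := 𝔖.centred hv
  intro h
  rw [h, Pi.zero_apply, norm_zero] at hpos
  exact lt_irrefl 0 hpos

/-- **An event occurs at time `t`** for the configuration `X` evolved at viscosity `ν`: `t > 0`,
the evolution `Φ_t X` is defined, and the evolved physical field satisfies the event predicate. [folklore] -/
def EventAt (ν : ℝ) (X : ℝ³ → ℝ³) (t : ℝ) : Prop :=
  0 < t ∧ ∃ v, classicalFlowAt ν t X = some v ∧ 𝔖.EventCompleted v

/-- **`t` is the first event time** of `X` (attained): an event occurs at `t` and at no earlier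
time. The instantiator should make `EventCompleted` a transversal crossing condition, so that the
first event time is attained whenever events occur. [folklore] -/
def IsFirstEventTime (ν : ℝ) (X : ℝ³ → ℝ³) (t : ℝ) : Prop :=
  𝔖.EventAt ν X t ∧ ∀ t' < t, ¬ 𝔖.EventAt ν X t'

/-- **The event functional `τ : Σ → (0, ∞]`**: the infimum in `[0, ∞]` of the event times of `X`
(`⊤` if no event ever occurs, `eventTime_eq_top_iff`; it may fail to be attained, and may be `0`
if events accumulate at `0` — in both cases the generation map is `none`). [folklore] -/
def eventTime (ν : ℝ) (X : ℝ³ → ℝ³) : ℝ≥0∞ :=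
  sInf ((fun t : ℝ => ENNReal.ofReal t) '' {t | 𝔖.EventAt ν X t})

variable {𝔖}

/-- **The first event time is unique.** [folklore] -/
theorem IsFirstEventTime.unique {ν : ℝ} {X : ℝ³ → ℝ³} {t t' : ℝ} (h : 𝔖.IsFirstEventTime ν X t)
    (h' : 𝔖.IsFirstEventTime ν X t') : t = t' := by
  by_contra hne
  rcases lt_or_gt_of_ne hne with hlt | hlt
  · exact h'.2 t hlt h.1
  · exact h.2 t' hlt h'.1

/-- No event ever occurs iff the event functional is `⊤`. [folklore] -/
theorem eventTime_eq_top_iff {ν : ℝ} {X : ℝ³ → ℝ³} :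
    𝔖.eventTime ν X = ⊤ ↔ ∀ t, ¬ 𝔖.EventAt ν X t := by
  rw [eventTime, sInf_eq_top]
  constructor
  · intro h t ht
    exact ENNReal.ofReal_ne_top (h _ ⟨t, ht, rfl⟩)
  · rintro h a ⟨t, ht, rfl⟩
    exact (h t ht).elim

/-- A first event time bounds the event functional from above: `τ X ≤ t`. [folklore] -/
theorem eventTime_le_of_eventAt {ν : ℝ} {X : ℝ³ → ℝ³} {t : ℝ} (h : 𝔖.EventAt ν X t) :
    𝔖.eventTime ν X ≤ ENNReal.ofReal t :=
  sInf_le ⟨t, h, rfl⟩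

variable (𝔖)

/-! ### The generation map -/

/-- **`Y` is a generation image of `X`** (viscosity `ν`, contraction `s`): `X ∈ Σ`, `Y ∈ Σ`, and
`Y = solenoidalTruncation (rigidAct Q b (generationRescale s (Φ_τ X))) ρ` for the first event time
`τ` of `X` and some rigid motion `(Q, b)` — evolve to the completion of the next merger,
renormalise, move the daughter to the normalised frame, localise. [folklore] -/
def IsGenerationImage (ν s : ℝ) (X Y : ℝ³ → ℝ³) : Prop :=
  X ∈ 𝔖.carrier ∧ Y ∈ 𝔖.carrier ∧
    ∃ (t : ℝ) (v : ℝ³ → ℝ³) (Q : ℝ³ ≃ₗᵢ[ℝ] ℝ³) (b : ℝ³),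
      𝔖.IsFirstEventTime ν X t ∧ classicalFlowAt ν t X = some v ∧
        Y = solenoidalTruncation (rigidAct Q b (generationRescale s v)) 𝔖.ρ

open Classical in
/-- **The generation map `𝓡` at viscosity `ν` with contraction `s`**: `𝓡 X = some Y` iff `Y` is
the unique generation image of `X` (`generationMap_eq_some_iff`); `none` if `X ∉ Σ`, if the
evolution does not stay classical (tame) up to the first event, if no event occurs or the first
event time is not attained, or if the normalised localised daughter is not unique in `Σ`
(route MergerLadder: `𝓡_n = g ∘ Φ_τ` read on the section; [Lanfordiii1982], §1: `T` on `𝒟(T)`). [cite: Lanfordiii1982, §1 (T : 𝒟(T) → M)] -/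
def generationMap (ν s : ℝ) (X : ℝ³ → ℝ³) : Option (ℝ³ → ℝ³) :=
  if h : ∃! Y, 𝔖.IsGenerationImage ν s X Y then some h.exists.choose else none

/-- **The Euler generation map `𝓡_∞`** (contraction `s`): the generation map of the inviscid
evolution, `ν = 0` — the object of the crux `GenerationMapFixedPoint`
(`∃ s ≥ 4, ∃ X, IsHyperbolicFixedPoint Σ (eulerGenerationMap s) X`). [folklore] -/
def eulerGenerationMap (s : ℝ) : (ℝ³ → ℝ³) → Option (ℝ³ → ℝ³) :=
  𝔖.generationMap 0 s

/-- **The Navier–Stokes generation map `𝓡_ν`** (contraction `s`, viscosity `ν`): the same with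
the viscous evolution. Along a ladder the renormalised viscosity halves at each generation
(`generationRescale` maps a viscosity-`ν` solution to a viscosity-`ν/2` one), so generation `n`
is `nsGenerationMap s (ν / 2 ^ n)` and `𝓡_ν → 𝓡_∞` formally as `n → ∞`. [folklore] -/
def nsGenerationMap (s ν : ℝ) : (ℝ³ → ℝ³) → Option (ℝ³ → ℝ³) :=
  𝔖.generationMap ν s

variable {𝔖}

/-- **Characterisation of the generation map**: `𝓡 X = some Y` iff `Y` is a generation image
of `X` and the only one. [folklore] -/
theorem generationMap_eq_some_iff {ν s : ℝ} {X Y : ℝ³ → ℝ³} :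
    𝔖.generationMap ν s X = some Y ↔
      𝔖.IsGenerationImage ν s X Y ∧ ∀ Y', 𝔖.IsGenerationImage ν s X Y' → Y' = Y := by
  classical
  by_cases h : ∃! Y, 𝔖.IsGenerationImage ν s X Y
  · have hc := h.exists.choose_spec
    rw [generationMap, dif_pos h]
    constructor
    · intro hY
      obtain rfl := Option.some_injective _ hY
      exact ⟨hc, fun Y' hY' => h.unique hY' hc⟩
    · rintro ⟨hY, huniq⟩
      exact congrArg some (huniq _ hc)
  · rw [generationMap, dif_neg h]
    constructor
    · intro hY
      exact (Option.some_ne_none Y hY.symm).elim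
    · rintro ⟨hY, huniq⟩
      exact (h ⟨Y, hY, huniq⟩).elim

/-- **`𝓡` is a partial self-map of the section**: if `𝓡 X = some Y` then `X ∈ Σ` and `Y ∈ Σ`
(the `mapsTo`/`mem` hypotheses of `IsHyperbolicFixedPointIn`). [folklore] -/
theorem mem_carrier_of_generationMap_eq_some {ν s : ℝ} {X Y : ℝ³ → ℝ³}
    (h : 𝔖.generationMap ν s X = some Y) : X ∈ 𝔖.carrier ∧ Y ∈ 𝔖.carrier := by
  obtain ⟨⟨hX, hY, -⟩, -⟩ := generationMap_eq_some_iff.1 h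
  exact ⟨hX, hY⟩

/-- Off the section the generation map is undefined. [folklore] -/
theorem generationMap_eq_none_of_not_mem {ν s : ℝ} {X : ℝ³ → ℝ³} (hX : X ∉ 𝔖.carrier) :
    𝔖.generationMap ν s X = none := by
  cases h : 𝔖.generationMap ν s X with
  | none => rfl
  | some Y => exact (hX (mem_carrier_of_generationMap_eq_some h).1).elim

/-- A value of the generation map is obtained at the (unique) first event time: if
`𝓡 X = some Y` then `X` has a first event time `t`, the evolution is defined at `t`, and `Y` is the
localised, normalised, renormalised evolved field. [folklore] -/
theorem exists_isFirstEventTime_of_generationMap_eq_some {ν s : ℝ} {X Y : ℝ³ → ℝ³}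
    (h : 𝔖.generationMap ν s X = some Y) :
    ∃ (t : ℝ) (v : ℝ³ → ℝ³) (Q : ℝ³ ≃ₗᵢ[ℝ] ℝ³) (b : ℝ³),
      𝔖.IsFirstEventTime ν X t ∧ classicalFlowAt ν t X = some v ∧
        Y = solenoidalTruncation (rigidAct Q b (generationRescale s v)) 𝔖.ρ :=
  (generationMap_eq_some_iff.1 h).1.2.2

/-- The Euler generation map is the generation map at `ν = 0` (definitional). [folklore] -/
@[simp]
theorem eulerGenerationMap_eq (s : ℝ) : 𝔖.eulerGenerationMap s = 𝔖.generationMap 0 s := rfl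

end MergerSection

end Literature.Analysis.FluidPDE
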